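import Summits.ValiantsHypothesis.ValiantsHypothesis.Theorems.FeketeSOSFeketeSOSHardPaleyRIPDefs
import Summits.ValiantsHypothesis.ValiantsHypothesis.Theorems.FeketeSOSCharPSparseSOSStubCharSum211

/-!
# Route FeketeSOS — crux `FeketeSOSHard` (stmt-ValiantsHypothesis-3996), line `paley-rip`,
# stub `stub_paleyCompletionBound`: the completion bound `|Q_p(S,w)| ≤ √p · Σ_{a∈S} |w_a|²`

Registered stub 4 [provable; the unconditional half of the engine `stub_paleyFlatRIP`] of the line of
record `Cruxes/FeketeSOSHard/Lines/paley_rip.lean`, proved VERBATIM (object `paleyForm` from the line's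
definitions file `Theorems/FeketeSOSFeketeSOSHardPaleyRIPDefs.lean`): for every prime `p`, every
`S ⊆ [0,p)` and every `w`, `|Q_p(S,w)| ≤ √p · Σ_{a∈S} |w_a|²`.

## Proof (completion + Jacobsthal)

`Q_p(S,w) = Σ_{a∈S} w_a u_a` with `u_a = Σ_{b∈S} χ_p(a+b) w_b`, so by Cauchy–Schwarz
`|Q| ≤ ‖w‖₂ · (Σ_{a∈S} |u_a|²)^{1/2}`; COMPLETE the outer sum to all residues `x ∈ ℤ/p`:
`Σ_{a∈S}|u_a|² ≤ Σ_x |Σ_b χ(x+b) w_b|² = Σ_{b,b'} w_b \bar w_{b'} J(b,b')` with the Jacobsthal sums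
`J(b,b') = Σ_x χ(x+b)χ(x+b') = p − 1` (`b = b'`) and `= −1` (`b ≠ b'`, `p` odd; tree
`cs_sum_quadraticChar_add_mul_add`; `= 0` for `p = 2`), whence
`Σ_x |U_x|² = (p−1−c)‖w‖² + c|Σ_b w_b|² ≤ p‖w‖²` (`c ∈ {−1, 0}`), and `|Q| ≤ √p ‖w‖₂²`.

With stub 1 (`stub_paleyMassIdentity`) this closes the line's unconditional residue `massFloor_of`.
Honest framing: the engine `stub_paleyFlatRIP` (flat RIP beyond √p), `stub_tameReduction` and the crux
`FeketeSOSHard` remain OPEN; nothing here bears on `VP ≠ VNP`.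
-/

set_option linter.dupNamespace false

namespace Summit.ValiantsHypothesis.ValiantsHypothesis.Theorems.FeketeSOSHardPaleyRIP

open Finset
open scoped BigOperators ComplexConjugate

noncomputable section

section Jacobsthal

variable (p : ℕ) [Fact p.Prime]

/-- `χ` is real: `conj χ(t) = χ(t)`. [folklore] -/
theorem conj_chiZ (t : ZMod p) :
    conj (((quadraticChar (ZMod p) t : ℤ) : ℂ)) = ((quadraticChar (ZMod p) t : ℤ) : ℂ) :=
  map_intCast _ _

/-- The Legendre symbol of `a + b` is the quadratic character of the residue `a + b`. [folklore] -/
theorem legendre_cast (a b : ℕ) :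
    ((legendreSym p ((a : ℤ) + b) : ℤ) : ℂ) = ((quadraticChar (ZMod p) ((a : ZMod p) + b) : ℤ) : ℂ) := by
  unfold legendreSym
  push_cast
  rfl

omit [Fact p.Prime] in
/-- The off-diagonal Jacobsthal constant `c = [p = 2]·0 + [p ≠ 2]·(−1)` is `0` or `−1`. [folklore] -/
theorem cOff_eq : (if p = 2 then (0 : ℂ) else -1) = 0 ∨ (if p = 2 then (0 : ℂ) else -1) = -1 := by
  split_ifs <;> simp

/-- Diagonal Jacobsthal sum: `Σ_x χ(x+b)² = p − 1`. [folklore] -/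
theorem jac_diag (b : ZMod p) :
    ∑ x : ZMod p, ((quadraticChar (ZMod p) (x + b) : ℤ) : ℂ) * ((quadraticChar (ZMod p) (x + b) : ℤ) : ℂ) =
      (p : ℂ) - 1 := by
  have hre := Equiv.sum_comp (Equiv.addRight b)
    (fun t => ((quadraticChar (ZMod p) t : ℤ) : ℂ) * ((quadraticChar (ZMod p) t : ℤ) : ℂ))
  simp only [Equiv.coe_addRight] at hre
  rw [hre]
  have h : ∀ t : ZMod p, ((quadraticChar (ZMod p) t : ℤ) : ℂ) * ((quadraticChar (ZMod p) t : ℤ) : ℂ) =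
      if t = 0 then (0 : ℂ) else 1 := by
    intro t
    split_ifs with ht
    · rw [ht, quadraticChar_zero]; simp
    · have := quadraticChar_sq_one ht
      rw [sq] at this
      exact_mod_cast this
  simp_rw [h]
  rw [Finset.sum_ite, Finset.sum_const_zero, zero_add, Finset.sum_const, nsmul_eq_mul, mul_one,
    Finset.filter_ne', Finset.card_erase_of_mem (Finset.mem_univ _), Finset.card_univ, ZMod.card]
  have hp : 1 ≤ p := (Fact.out : p.Prime).one_lt.le
  push_cast [Nat.cast_sub hp]
  ring

/-- In `ℤ/2`, `(x + b)(x + b') = 0` whenever `b ≠ b'` (one factor is `0`). [folklore] -/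
theorem zmod_two_add_mul_add_eq_zero : ∀ b b' x : ZMod 2, b ≠ b' → (x + b) * (x + b') = 0 := by
  decide

/-- Off-diagonal Jacobsthal sum: `Σ_x χ(x+b)χ(x+b') = c` for `b ≠ b'` (`−1` for odd `p` by the tree's
`cs_sum_quadraticChar_add_mul_add`; `0` for `p = 2` by inspection). [folklore] -/
theorem jac_off {b b' : ZMod p} (h : b ≠ b') :
    ∑ x : ZMod p, ((quadraticChar (ZMod p) (x + b) : ℤ) : ℂ) * ((quadraticChar (ZMod p) (x + b') : ℤ) : ℂ) =
      (if p = 2 then (0 : ℂ) else -1) := by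
  have hmul : ∀ x : ZMod p,
      ((quadraticChar (ZMod p) (x + b) : ℤ) : ℂ) * ((quadraticChar (ZMod p) (x + b') : ℤ) : ℂ) =
      ((quadraticChar (ZMod p) ((x + b) * (x + b')) : ℤ) : ℂ) := by
    intro x; rw [map_mul]; push_cast; ring
  simp_rw [hmul]
  rw [← Int.cast_sum]
  split_ifs with hp
  · subst hp
    have hz : ∀ x : ZMod 2, (x + b) * (x + b') = 0 := fun x => zmod_two_add_mul_add_eq_zero b b' x h
    rw [Finset.sum_eq_zero (fun x _ => by rw [hz x, quadraticChar_zero])]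
    push_cast
    rfl
  · rw [CharPSparseSOSTraceBias.cs_sum_quadraticChar_add_mul_add p hp h]
    push_cast
    ring

end Jacobsthal


section Completion

variable (p : ℕ) [Fact p.Prime]

/-! The COMPLETED linear forms `U_x(w) = Σ_{b∈S} χ(x+b) w_b` on all residues `x ∈ ℤ/p` are spelled
out in every statement below as `∑ b ∈ S, χ(x + b) · w b`. -/

/-- The Jacobsthal table on naturals `b, b' < p`: `Σ_x χ(x+b)χ(x+b')` is `p − 1` on the diagonal and the
constant `c` off it. [folklore] -/
theorem jac_nat {S : Finset ℕ} (hS : ∀ a ∈ S, a < p) {b b' : ℕ} (hb : b ∈ S) (hb' : b' ∈ S) :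
    ∑ x : ZMod p, ((quadraticChar (ZMod p) (x + (b : ZMod p)) : ℤ) : ℂ) *
        ((quadraticChar (ZMod p) (x + (b' : ZMod p)) : ℤ) : ℂ) =
      if b = b' then (p : ℂ) - 1 else (if p = 2 then (0 : ℂ) else -1) := by
  by_cases h : b = b'
  · subst h; rw [if_pos rfl]; exact jac_diag p _
  · rw [if_neg h]
    refine jac_off p fun hcast => h ?_
    have h2 := (ZMod.natCast_eq_natCast_iff' b b' p).1 hcast
    rwa [Nat.mod_eq_of_lt (hS b hb), Nat.mod_eq_of_lt (hS b' hb')] at h2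

/-- **Completion identity.** `Σ_x |U_x|² = (p − 1 − c) Σ_b |w_b|² + c |Σ_b w_b|²` (as complex numbers).
[folklore] -/
theorem sum_normSq_uForm {S : Finset ℕ} (hS : ∀ a ∈ S, a < p) (w : ℕ → ℂ) :
    (∑ x : ZMod p, ((‖∑ b ∈ S, ((quadraticChar (ZMod p) (x + (b : ZMod p)) : ℤ) : ℂ) * w b‖ : ℂ) ^ 2)) =
      ((p : ℂ) - 1 - (if p = 2 then (0 : ℂ) else -1)) * ∑ b ∈ S, ((‖w b‖ : ℂ) ^ 2) +
        (if p = 2 then (0 : ℂ) else -1) * ((‖∑ b ∈ S, w b‖ : ℂ) ^ 2) := by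
  -- expand `|U_x|² = U_x · conj U_x` and swap the sums
  have hexp : ∀ x : ZMod p,
      ((‖∑ b ∈ S, ((quadraticChar (ZMod p) (x + (b : ZMod p)) : ℤ) : ℂ) * w b‖ : ℂ) ^ 2) =
      ∑ b ∈ S, ∑ b' ∈ S, (w b * conj (w b')) *
        (((quadraticChar (ZMod p) (x + (b : ZMod p)) : ℤ) : ℂ) *
          ((quadraticChar (ZMod p) (x + (b' : ZMod p)) : ℤ) : ℂ)) := by
    intro x
    rw [← Complex.mul_conj', map_sum, Finset.sum_mul_sum]
    refine Finset.sum_congr rfl fun b _ => Finset.sum_congr rfl fun b' _ => ?_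
    rw [map_mul, conj_chiZ]
    ring
  simp_rw [hexp]
  rw [Finset.sum_comm]
  simp_rw [Finset.sum_comm (s := (Finset.univ : Finset (ZMod p))), ← Finset.mul_sum]
  -- insert the Jacobsthal table
  have htab : ∀ b ∈ S, ∀ b' ∈ S,
      w b * conj (w b') * ∑ x : ZMod p, ((quadraticChar (ZMod p) (x + (b : ZMod p)) : ℤ) : ℂ) *
          ((quadraticChar (ZMod p) (x + (b' : ZMod p)) : ℤ) : ℂ) =
        (if p = 2 then (0 : ℂ) else -1) * (w b * conj (w b')) +
          (if b = b' then ((p : ℂ) - 1 - (if p = 2 then (0 : ℂ) else -1)) * (w b * conj (w b')) else 0) := by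
    intro b hb b' hb'
    rw [jac_nat p hS hb hb']
    split_ifs <;> ring
  rw [Finset.sum_congr rfl fun b hb => Finset.sum_congr rfl fun b' hb' => htab b hb b' hb']
  have hsplit : ∀ b ∈ S, (∑ b' ∈ S, ((if p = 2 then (0 : ℂ) else -1) * (w b * conj (w b')) +
      (if b = b' then ((p : ℂ) - 1 - (if p = 2 then (0 : ℂ) else -1)) * (w b * conj (w b')) else 0))) =
      (if p = 2 then (0 : ℂ) else -1) * (w b * ∑ b' ∈ S, conj (w b')) +
        ((p : ℂ) - 1 - (if p = 2 then (0 : ℂ) else -1)) * ((‖w b‖ : ℂ) ^ 2) := by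
    intro b hb
    rw [Finset.sum_add_distrib, Finset.sum_ite_eq, if_pos hb, ← Finset.mul_sum, ← Finset.mul_sum,
      Complex.mul_conj']
  rw [Finset.sum_congr rfl hsplit, Finset.sum_add_distrib, ← Finset.mul_sum, ← Finset.mul_sum,
    ← Finset.sum_mul, ← map_sum, Complex.mul_conj']
  ring

/-- **Completion bound.** `Σ_x |U_x|² ≤ p · Σ_{b∈S} |w_b|²`. [folklore] -/
theorem sum_normSq_uForm_le {S : Finset ℕ} (hS : ∀ a ∈ S, a < p) (w : ℕ → ℂ) :
    ∑ x : ZMod p, ‖∑ b ∈ S, ((quadraticChar (ZMod p) (x + (b : ZMod p)) : ℤ) : ℂ) * w b‖ ^ 2 ≤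
      (p : ℝ) * ∑ b ∈ S, ‖w b‖ ^ 2 := by
  have key := sum_normSq_uForm p hS w
  have hN : 0 ≤ ∑ b ∈ S, ‖w b‖ ^ 2 := Finset.sum_nonneg fun b _ => sq_nonneg _
  rcases cOff_eq p with hc | hc
  · rw [hc] at key
    have h' : ∑ x : ZMod p, ‖∑ b ∈ S, ((quadraticChar (ZMod p) (x + (b : ZMod p)) : ℤ) : ℂ) * w b‖ ^ 2 =
        ((p : ℝ) - 1) * ∑ b ∈ S, ‖w b‖ ^ 2 := by
      apply Complex.ofReal_injective
      push_cast
      rw [key]; ring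
    rw [h']
    nlinarith
  · rw [hc] at key
    have h' : ∑ x : ZMod p, ‖∑ b ∈ S, ((quadraticChar (ZMod p) (x + (b : ZMod p)) : ℤ) : ℂ) * w b‖ ^ 2 =
        (p : ℝ) * ∑ b ∈ S, ‖w b‖ ^ 2 - ‖∑ b ∈ S, w b‖ ^ 2 := by
      apply Complex.ofReal_injective
      push_cast
      rw [key]; ring
    rw [h']
    nlinarith [sq_nonneg ‖∑ b ∈ S, w b‖]

/-- Restricting the completed sum to the residues of `S` (distinct, as `S ⊆ [0,p)`). [folklore] -/
theorem sum_normSq_restrict_le {S : Finset ℕ} (hS : ∀ a ∈ S, a < p) (w : ℕ → ℂ) :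
    ∑ a ∈ S, ‖∑ b ∈ S, ((quadraticChar (ZMod p) ((a : ZMod p) + (b : ZMod p)) : ℤ) : ℂ) * w b‖ ^ 2 ≤
      ∑ x : ZMod p, ‖∑ b ∈ S, ((quadraticChar (ZMod p) (x + (b : ZMod p)) : ℤ) : ℂ) * w b‖ ^ 2 := by
  classical
  have hinj : Set.InjOn (fun a : ℕ => (a : ZMod p)) S := by
    intro a ha a' ha' h
    have h2 := (ZMod.natCast_eq_natCast_iff' a a' p).1 h
    rwa [Nat.mod_eq_of_lt (hS a ha), Nat.mod_eq_of_lt (hS a' ha')] at h2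
  rw [← Finset.sum_image
    (f := fun x : ZMod p => ‖∑ b ∈ S, ((quadraticChar (ZMod p) (x + (b : ZMod p)) : ℤ) : ℂ) * w b‖ ^ 2) hinj]
  exact Finset.sum_le_univ_sum_of_nonneg fun x => sq_nonneg _

/-- The Paley–Hankel form as a pairing with the completed forms: `Q_p(S,w) = Σ_{a∈S} w_a · U_a(w)`.
[folklore] -/
theorem paleyForm_eq_sum_mul_uForm (S : Finset ℕ) (w : ℕ → ℂ) :
    paleyForm p S w =
      ∑ a ∈ S, w a * ∑ b ∈ S, ((quadraticChar (ZMod p) ((a : ZMod p) + (b : ZMod p)) : ℤ) : ℂ) * w b := by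
  unfold paleyForm
  refine Finset.sum_congr rfl fun a _ => ?_
  rw [Finset.mul_sum]
  refine Finset.sum_congr rfl fun b _ => ?_
  rw [legendre_cast]
  ring

end Completion

/-- **Stub 4 `stub_paleyCompletionBound` — the completion bound** (line `paley-rip` of crux
`FeketeSOSHard`, stmt-ValiantsHypothesis-3996; registered signature verbatim): for every prime `p`, every
`S ⊆ [0,p)` and every `w`, `|Q_p(S,w)| ≤ √p · Σ_{a∈S} |w_a|²` — Cauchy–Schwarz against the completed
forms `U_x`, whose total energy is `≤ p‖w‖²` by the Jacobsthal sums. -/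
theorem stub_paleyCompletionBound :
    ∀ (p : ℕ) [Fact p.Prime] (S : Finset ℕ), (∀ a ∈ S, a < p) → ∀ (w : ℕ → ℂ),
      ‖paleyForm p S w‖ ≤ Real.sqrt p * ∑ a ∈ S, ‖w a‖ ^ 2 := by
  intro p _ S hS w
  set W : ℝ := ∑ a ∈ S, ‖w a‖ ^ 2 with hW
  have hW0 : 0 ≤ W := Finset.sum_nonneg fun a _ => sq_nonneg _
  -- `|Q| ≤ Σ_a |w_a| |U_a|`
  have h1 : ‖paleyForm p S w‖ ≤ ∑ a ∈ S, ‖w a‖ * ‖∑ b ∈ S, ((quadraticChar (ZMod p) ((a : ZMod p) + (b : ZMod p)) : ℤ) : ℂ) * w b‖ := by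
    rw [paleyForm_eq_sum_mul_uForm]
    refine (norm_sum_le _ _).trans (le_of_eq ?_)
    exact Finset.sum_congr rfl fun a _ => norm_mul _ _
  -- Cauchy–Schwarz and the completion bound
  have h2 : (∑ a ∈ S, ‖w a‖ * ‖∑ b ∈ S, ((quadraticChar (ZMod p) ((a : ZMod p) + (b : ZMod p)) : ℤ) : ℂ) * w b‖) ^ 2 ≤ W * ((p : ℝ) * W) := by
    refine (Finset.sum_mul_sq_le_sq_mul_sq S (fun a => ‖w a‖) fun a => ‖∑ b ∈ S, ((quadraticChar (ZMod p) ((a : ZMod p) + (b : ZMod p)) : ℤ) : ℂ) * w b‖).trans ?_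
    rw [hW]
    exact mul_le_mul_of_nonneg_left
      ((sum_normSq_restrict_le p hS w).trans (sum_normSq_uForm_le p hS w)) hW0
  have h3 : ∑ a ∈ S, ‖w a‖ * ‖∑ b ∈ S, ((quadraticChar (ZMod p) ((a : ZMod p) + (b : ZMod p)) : ℤ) : ℂ) * w b‖ ≤ Real.sqrt p * W := by
    have hx : 0 ≤ ∑ a ∈ S, ‖w a‖ * ‖∑ b ∈ S, ((quadraticChar (ZMod p) ((a : ZMod p) + (b : ZMod p)) : ℤ) : ℂ) * w b‖ :=
      Finset.sum_nonneg fun a _ => mul_nonneg (norm_nonneg _) (norm_nonneg _)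
    have hy : 0 ≤ Real.sqrt p * W := mul_nonneg (Real.sqrt_nonneg _) hW0
    have h2' : (∑ a ∈ S, ‖w a‖ * ‖∑ b ∈ S, ((quadraticChar (ZMod p) ((a : ZMod p) + (b : ZMod p)) : ℤ) : ℂ) * w b‖) ^ 2 ≤ (Real.sqrt p * W) ^ 2 := by
      calc (∑ a ∈ S, ‖w a‖ * ‖∑ b ∈ S, ((quadraticChar (ZMod p) ((a : ZMod p) + (b : ZMod p)) : ℤ) : ℂ) * w b‖) ^ 2 ≤ W * ((p : ℝ) * W) := h2
        _ = (Real.sqrt p * W) ^ 2 := by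
            rw [mul_pow, Real.sq_sqrt (Nat.cast_nonneg p)]; ring
    have h4 := (Real.le_sqrt hx (sq_nonneg _)).2 h2'
    rwa [Real.sqrt_sq hy] at h4
  exact h1.trans h3

end

end Summit.ValiantsHypothesis.ValiantsHypothesis.Theorems.FeketeSOSHardPaleyRIP
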